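import Literature.Topology.FourManifolds.FramedSphereFamilyTransversality
import HarnessLib

/-!
# The modified fibre coordinate of a tube, bent into chart position near the crossings

Topic `Literature/Topology/FourManifolds` (fact seat
`provefact-Literature.Topology.FourManifolds.Matvey-69322e0896`, rung (H4)
`Literature.Topology.FourManifolds.Matveyev1996_partOne_and_fact_of_dualSpheres` of
`CorkDecompositionMiddleLevel.lean`).  The printed proofs of the cork decomposition theorem
start from the regular neighbourhood of the middle-level configuration of spheres —
Matveyev 1996 (arXiv:dg-ga/9505001), p. 1: *"Put `V₀ = Nd_N(S_* ∪ P_*)`"*; Kirby 1996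
(arXiv:math/9712231), §3 — the union of the tubes about the `Sᵢ` and about the `Pⱼ`, plumbed
at the finitely many crossings (Milnor, *Lectures on the h-cobordism theorem* (1965), PDF
p. 27: at a crossing the two spheres are complementary coordinate planes of a chart;
`PlumbingAdaptedChartNormalised.lean`).  In the tree `V₀` is to be a regular sublevel set
`{g ≤ 0}` (`RegularLevelSplitting.lean`, `SurgeryRegularDomain.lean`), with `g` a smooth
minimum of two squared fibre-distance functions, one for each family; for the minimum to have
a regular zero level through the plumbed region, the fibre distance of the tube of `Sᵢ` must,
near a crossing with `Pⱼ`, be *the chart coordinate* `‖Y‖` of the adapted chart `(X, Y)` in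
which `Sᵢ = {Y = 0}` and `Pⱼ = {X = 0}`.  This file performs that modification of the fibre
coordinate (the device of the tubular neighbourhood theorem in a trivialised normal bundle,
Hirsch, *Differential Topology* (1976), Ch. 4 §5; Lang, *Fundamentals of Differential
Geometry* (1999), IV §5: any map of the tube which vanishes on the zero section and has
fibre derivative the identity along it is as good a fibre coordinate as the honest one near
the zero section).  Everything is proved; no definitions, no named facts:

* `Literature.Topology.FourManifolds.FramedSphereFamily.exists_modifiedFibreCoordinate` —
  for the `i`-th tube `φᵢ : Sᵃ × ℝᵇ → N` of a framed family, finitely many charts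
  `Ψ_c : N ⇀ ℝᵃ × ℝᵇ` and smooth bump functions `χ_c` with `tsupport χ_c ⊆ (Ψ_c).source`,
  such that wherever the core sphere `Sᵢ` meets `tsupport χ_c` the chart has `Sᵢ ⊆ {Ψ_c,₂ = 0}`
  and normalised fibre derivative `d(w ↦ Ψ_c,₂(φᵢ(x, w)))_0 = id` (the output of
  `FramedSphereFamily.exists_adaptedChart`), the **modified fibre coordinate**
  `F(z) = Σ_c χ_c(z) Ψ_c,₂(z) + (1 - Σ_c χ_c(z)) pr₂(φᵢ⁻¹ z)` is smooth on the tube, vanishes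
  on the core sphere, has fibre derivative the identity along it
  (`d(w ↦ F(φᵢ(x, w)))_0 = id` for every `x`), equals the chart coordinate `Ψ_c,₂` where
  `χ_c = 1` (and the other bumps vanish), and equals the honest fibre coordinate
  `pr₂ ∘ φᵢ⁻¹` off the supports of the bumps.

## References

* R. Matveyev, *A decomposition of smooth simply-connected h-cobordant 4-manifolds*,
  J. Differential Geom. 44 (1996) 571–582; arXiv:dg-ga/9505001, Proof of Theorem, p. 1.
  [Matveyev1996]
* R. Kirby, *Akbulut's corks and h-cobordisms of smooth, simply connected 4-manifolds*, Turkish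
  J. Math. 20 (1996) 85–93; arXiv:math/9712231, §3. [KirbyCorks1996]
* J. Milnor, *Lectures on the h-cobordism theorem*, Princeton (1965), Def. 3.9 (PDF p. 16),
  PDF p. 27. [MilnorHCobordism1965]
* M. W. Hirsch, *Differential Topology*, GTM 33 (1976), Ch. 4 §5, Thm. 5.1 and its proof.
  [HirschDT1976]
-/

open scoped Manifold ContDiff Topology
open Set Function

noncomputable section

namespace Literature.Topology.FourManifolds

universe u v w

namespace FramedSphereFamily

variable {n a b : ℕ} {N : Type u} [TopologicalSpace N]
  [ChartedSpace (EuclideanSpace ℝ (Fin n)) N] {ι : Type v}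

/-- **The modified fibre coordinate of a tube.**  Let `φᵢ : Sᵃ × ℝᵇ → N` be the `i`-th tube
of a framed family `S`, and let `Ψ_c : N ⇀ ℝᵃ × ℝᵇ` (`c ∈ C`, finite) be charts, smooth on
their domains, with smooth functions `χ_c : N → ℝ` supported inside the domains
(`tsupport χ_c ⊆ (Ψ_c).source`), such that at every point `Sᵢ(x)` of `tsupport χ_c` the
second chart coordinate vanishes (`Ψ_c,₂(Sᵢ x) = 0`: the sphere lies in the plane
`{Ψ_c,₂ = 0}`) and the fibre derivative of the tube read in the chart is normalised,
`d(w ↦ Ψ_c,₂(φᵢ(x, w)))_0 = id` (the adapted charts at the crossings,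
`FramedSphereFamily.exists_adaptedChart`, with bumps concentrated at the crossings).  Then
there is a map `F : N → ℝᵇ` — the fibre coordinate `pr₂ ∘ φᵢ⁻¹` bent into the chart
coordinate `Ψ_c,₂` by the bumps, `F = Σ_c χ_c • Ψ_c,₂ + (1 - Σ_c χ_c) • pr₂ ∘ φᵢ⁻¹` — which
is `C^∞` on the tube `φᵢ(Sᵃ × ℝᵇ)`, vanishes on the core sphere, has fibre derivative the
identity along the core sphere (`d(w ↦ F(φᵢ(x, w)))_0 = id` for every `x`; by the product
rule, the derivatives of the bumps being multiplied by values that vanish on the sphere),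
equals `Ψ_c,₂` at points where `χ_c = 1` and the other bumps vanish, and equals the honest
fibre coordinate, `F(φᵢ(x, w)) = w`, at points where all the bumps vanish.  (The device of
the tubular neighbourhood theorem in a trivialised normal bundle, Hirsch 1976, Ch. 4 §5;
here preparing the plumbing of the tubes of `S_*` and `P_*` at their crossings, Matveyev
1996, p. 1, `V₀ = Nd_N(S_* ∪ P_*)`; Milnor 1965, PDF p. 27.)
[cite: HirschDT1976, Ch. 4 §5, proof of Thm. 5.1] [cite: Matveyev1996, Proof of Theorem (arXiv p. 1)]
[cite: MilnorHCobordism1965, Def. 3.9 (PDF p. 16), PDF p. 27] -/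
theorem exists_modifiedFibreCoordinate (S : FramedSphereFamily (𝓡 n) N ι a b) (i : ι)
    {C : Type w} [Fintype C]
    (Ψ : C → OpenPartialHomeomorph N (EuclideanSpace ℝ (Fin a) × EuclideanSpace ℝ (Fin b)))
    (χ : C → N → ℝ)
    (hΨ : ∀ c, ContMDiffOn (𝓡 n) 𝓘(ℝ, EuclideanSpace ℝ (Fin a) × EuclideanSpace ℝ (Fin b)) ∞
      (Ψ c) (Ψ c).source)
    (hχ : ∀ c, ContMDiff (𝓡 n) 𝓘(ℝ, ℝ) ∞ (χ c))
    (hsupp : ∀ c, tsupport (χ c) ⊆ (Ψ c).source)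
    (hplane : ∀ c x, S.sphere i x ∈ tsupport (χ c) → (Ψ c (S.sphere i x)).2 = 0)
    (hnorm : ∀ c x, S.sphere i x ∈ tsupport (χ c) →
      HasFDerivAt (fun w : EuclideanSpace ℝ (Fin b) => (Ψ c (S.toFun i (x, w))).2)
        (ContinuousLinearMap.id ℝ (EuclideanSpace ℝ (Fin b))) 0) :
    ∃ F : N → EuclideanSpace ℝ (Fin b),
      ContMDiffOn (𝓡 n) 𝓘(ℝ, EuclideanSpace ℝ (Fin b)) ∞ F (range (S.toFun i)) ∧
      (∀ x, F (S.sphere i x) = 0) ∧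
      (∀ x, HasFDerivAt (fun w : EuclideanSpace ℝ (Fin b) => F (S.toFun i (x, w)))
        (ContinuousLinearMap.id ℝ (EuclideanSpace ℝ (Fin b))) 0) ∧
      (∀ c z, χ c z = 1 → (∀ c', c' ≠ c → χ c' z = 0) → F z = (Ψ c z).2) ∧
      (∀ x w, (∀ c, χ c (S.toFun i (x, w)) = 0) → F (S.toFun i (x, w)) = w) := by
  classical
  -- the tube chart `k` (`k = φᵢ`, an open partial homeomorphism with smooth inverse)
  haveI : Nonempty (Metric.sphere (0 : EuclideanSpace ℝ (Fin (a + 1))) 1 ×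
      EuclideanSpace ℝ (Fin b)) :=
    ⟨(⟨EuclideanSpace.single 0 1, by simp⟩, 0)⟩
  obtain ⟨k, hksrc, hktgt, hkq, -, hk'⟩ := S.exists_tube_openPartialHomeomorph i
  have hkmem : ∀ q, q ∈ k.source := fun q => by rw [hksrc]; exact mem_univ _
  have hksymm : ∀ q, k.symm (S.toFun i q) = q := fun q => by
    rw [← hkq q]; exact k.left_inv (hkmem q)
  -- smoothness of the projections of the model product
  have hsnd : ContMDiff 𝓘(ℝ, EuclideanSpace ℝ (Fin a) × EuclideanSpace ℝ (Fin b))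
      𝓘(ℝ, EuclideanSpace ℝ (Fin b)) ∞
      (Prod.snd : EuclideanSpace ℝ (Fin a) × EuclideanSpace ℝ (Fin b) → EuclideanSpace ℝ (Fin b)) :=
    (ContinuousLinearMap.snd ℝ (EuclideanSpace ℝ (Fin a)) (EuclideanSpace ℝ (Fin b))).contMDiff
  -- the modified fibre coordinate
  set F : N → EuclideanSpace ℝ (Fin b) := fun z =>
    (∑ c, χ c z • (Ψ c z).2) + (1 - ∑ c, χ c z) • (k.symm z).2 with hF_def
  -- each bent term `χ_c • Ψ_c,₂` is smooth on all of `N`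
  have hterm : ∀ c, ContMDiff (𝓡 n) 𝓘(ℝ, EuclideanSpace ℝ (Fin b)) ∞
      fun z => χ c z • (Ψ c z).2 := by
    intro c
    refine contMDiff_of_tsupport fun z hz => ?_
    have hz' : z ∈ (Ψ c).source := hsupp c (tsupport_smul_subset_left _ _ hz)
    have h1 : ContMDiffAt (𝓡 n) 𝓘(ℝ, EuclideanSpace ℝ (Fin a) × EuclideanSpace ℝ (Fin b)) ∞
        (Ψ c) z := ((hΨ c) z hz').contMDiffAt ((Ψ c).open_source.mem_nhds hz')
    exact ((hχ c) z).smul (hsnd.contMDiffAt.comp z h1)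
  have hsum : ContMDiff (𝓡 n) 𝓘(ℝ, EuclideanSpace ℝ (Fin b)) ∞
      fun z => ∑ c, χ c z • (Ψ c z).2 :=
    ContMDiff.sum fun c _ => hterm c
  have hχsum : ContMDiff (𝓡 n) 𝓘(ℝ, ℝ) ∞ fun z => 1 - ∑ c, χ c z :=
    contMDiff_const.sub (ContMDiff.sum fun c _ => hχ c)
  -- values of the bumps off their supports
  have hχ0 : ∀ c z, z ∉ tsupport (χ c) → χ c z = 0 := fun c z hz =>
    image_eq_zero_of_notMem_tsupport hz
  refine ⟨F, ?_, ?_, ?_, ?_, ?_⟩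
  · -- smoothness on the tube
    have h2 : ContMDiffOn (𝓡 n) 𝓘(ℝ, EuclideanSpace ℝ (Fin b)) ∞
        (fun z => (k.symm z).2) (range (S.toFun i)) := by
      rw [← hktgt]
      exact contMDiff_snd.comp_contMDiffOn hk'
    exact (hsum.contMDiffOn.add (hχsum.contMDiffOn.smul h2)).congr fun z _ => rfl
  · -- `F` vanishes on the core sphere
    intro x
    have hx0 : (k.symm (S.sphere i x)).2 = 0 := by
      rw [S.sphere_apply, hksymm]
    have hs : ∀ c, χ c (S.sphere i x) • (Ψ c (S.sphere i x)).2 = 0 := by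
      intro c
      by_cases hx : S.sphere i x ∈ tsupport (χ c)
      · rw [hplane c x hx, smul_zero]
      · rw [hχ0 c _ hx, zero_smul]
    simp only [hF_def, hx0, smul_zero, add_zero]
    exact Finset.sum_eq_zero fun c _ => hs c
  · -- the fibre derivative along the core sphere is the identity
    intro x
    -- the bumps read along the fibre over `x`
    set σ : C → EuclideanSpace ℝ (Fin b) → ℝ := fun c w => χ c (S.toFun i (x, w)) with hσ_def
    have hσsm : ∀ c, ContMDiff 𝓘(ℝ, EuclideanSpace ℝ (Fin b)) 𝓘(ℝ, ℝ) ∞ (σ c) := fun c =>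
      (hχ c).comp ((S.contMDiff i).comp (contMDiff_const.prodMk contMDiff_id))
    have hσd : ∀ c, HasFDerivAt (σ c) (fderiv ℝ (σ c) 0) 0 := fun c =>
      (((contMDiff_iff_contDiff.1 (hσsm c)).differentiable (by simp)) 0).hasFDerivAt
    have hσ0 : ∀ c, σ c 0 = χ c (S.sphere i x) := fun c => by rw [hσ_def, S.sphere_apply]
    -- each bent term has derivative `χ_c(Sᵢ x) • id`
    have hone : ∀ c, HasFDerivAt
        (fun w : EuclideanSpace ℝ (Fin b) => σ c w • (Ψ c (S.toFun i (x, w))).2)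
        (χ c (S.sphere i x) • ContinuousLinearMap.id ℝ (EuclideanSpace ℝ (Fin b))) 0 := by
      intro c
      by_cases hx : S.sphere i x ∈ tsupport (χ c)
      · have h := (hσd c).fun_smul (hnorm c x hx)
        have h0 : (Ψ c (S.toFun i (x, 0))).2 = 0 := by
          rw [← S.sphere_apply]; exact hplane c x hx
        rw [h0, ContinuousLinearMap.smulRight_zero, add_zero, hσ0] at h
        exact h
      · -- off the support the term vanishes near `w = 0`
        have hopen : IsOpen ((fun w : EuclideanSpace ℝ (Fin b) => S.toFun i (x, w)) ⁻¹'
            (tsupport (χ c))ᶜ) :=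
          (isClosed_tsupport _).isOpen_compl.preimage
            ((S.continuous i).comp (by fun_prop))
        have hmem : (0 : EuclideanSpace ℝ (Fin b)) ∈
            (fun w : EuclideanSpace ℝ (Fin b) => S.toFun i (x, w)) ⁻¹' (tsupport (χ c))ᶜ := by
          show S.toFun i (x, 0) ∉ tsupport (χ c)
          rwa [← S.sphere_apply]
        have hev : (fun w : EuclideanSpace ℝ (Fin b) => σ c w • (Ψ c (S.toFun i (x, w))).2)
            =ᶠ[𝓝 0] fun _ => 0 := by
          filter_upwards [hopen.mem_nhds hmem] with w hw
          show χ c (S.toFun i (x, w)) • _ = 0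
          rw [hχ0 c _ hw, zero_smul]
        have h0d : HasFDerivAt
            (fun w : EuclideanSpace ℝ (Fin b) => σ c w • (Ψ c (S.toFun i (x, w))).2)
            (0 : EuclideanSpace ℝ (Fin b) →L[ℝ] EuclideanSpace ℝ (Fin b)) 0 :=
          (hasFDerivAt_const (0 : EuclideanSpace ℝ (Fin b)) 0).congr_of_eventuallyEq hev
        have hz : (0 : ℝ) • ContinuousLinearMap.id ℝ (EuclideanSpace ℝ (Fin b)) = 0 := by
          ext1 v; simp
        rw [hχ0 c _ hx, hz]
        exact h0d
    have hsumd : HasFDerivAt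
        (fun w : EuclideanSpace ℝ (Fin b) => ∑ c, σ c w • (Ψ c (S.toFun i (x, w))).2)
        (∑ c, χ c (S.sphere i x) • ContinuousLinearMap.id ℝ (EuclideanSpace ℝ (Fin b))) 0 :=
      HasFDerivAt.fun_sum fun c _ => hone c
    -- the straight term `(1 - Σ χ_c) • w`
    have hlast : HasFDerivAt
        (fun w : EuclideanSpace ℝ (Fin b) => (1 - ∑ c, σ c w) • (k.symm (S.toFun i (x, w))).2)
        ((1 - ∑ c, χ c (S.sphere i x)) • ContinuousLinearMap.id ℝ (EuclideanSpace ℝ (Fin b)))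
        0 := by
      have hfun : (fun w : EuclideanSpace ℝ (Fin b) =>
          (1 - ∑ c, σ c w) • (k.symm (S.toFun i (x, w))).2) =
          fun w => (1 - ∑ c, σ c w) • w := by
        funext w
        rw [hksymm]
      rw [hfun]
      have h1 : HasFDerivAt (fun w : EuclideanSpace ℝ (Fin b) => 1 - ∑ c, σ c w)
          (0 - ∑ c, fderiv ℝ (σ c) 0) 0 :=
        (hasFDerivAt_const (1 : ℝ) 0).sub (HasFDerivAt.fun_sum fun c _ => hσd c)
      have h := h1.fun_smul (hasFDerivAt_id (𝕜 := ℝ) (0 : EuclideanSpace ℝ (Fin b)))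
      simp only [id_eq, ContinuousLinearMap.smulRight_zero, add_zero, hσ0] at h
      exact h
    have htot := hsumd.add hlast
    refine htot.congr_fderiv ?_
    rw [← Finset.sum_smul, ← add_smul, add_sub_cancel, one_smul]
  · -- where `χ_c = 1` and the other bumps vanish, `F = Ψ_c,₂`
    intro c z h1 h0
    have hs : ∑ c', χ c' z • (Ψ c' z).2 = (Ψ c z).2 := by
      rw [Finset.sum_eq_single c (fun c' _ hc' => by rw [h0 c' hc', zero_smul])
        (fun h => absurd (Finset.mem_univ c) h), h1, one_smul]
    have hs' : ∑ c', χ c' z = 1 := by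
      rw [Finset.sum_eq_single c (fun c' _ hc' => h0 c' hc') (fun h => absurd (Finset.mem_univ c) h),
        h1]
    simp only [hF_def, hs, hs', sub_self, zero_smul, add_zero]
  · -- off the supports of the bumps, `F` is the honest fibre coordinate
    intro x w h0
    have hs : ∑ c, χ c (S.toFun i (x, w)) • (Ψ c (S.toFun i (x, w))).2 = 0 :=
      Finset.sum_eq_zero fun c _ => by rw [h0 c, zero_smul]
    have hs' : ∑ c, χ c (S.toFun i (x, w)) = 0 := Finset.sum_eq_zero fun c _ => h0 c
    simp only [hF_def, hs, hs', sub_zero, one_smul, zero_add, hksymm]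

end FramedSphereFamily

end Literature.Topology.FourManifolds

end
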